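/-
Copyright: internal research formalization. Source texts: G. Kempf, F. Knudsen, D. Mumford,
B. Saint-Donat, Toroidal Embeddings I (LNM 339, Springer 1973) [KempfEtAl1973], Ch. II §1 Def. 5
(conical polyhedral complexes with integral structure, given by charts) and §2 (Theorems 4*, 9*,
11*: the subdivision theorems of Ch. I §2 carry over to complexes); K. Kato, Toric singularities,
Amer. J. Math. 116 (1994) [Kato1994], (9.6)–(9.8) (the fan of a log regular scheme is such a
complex, covered by the charts of the scheme).
-/
import Mathlib
import HarnessLib
import Literature.Geometry.PolyhedralFans.LinkTransport
import Literature.Geometry.PolyhedralFans.MultiStarSubdivision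
import Literature.Geometry.PolyhedralFans.LinkedRefinement

/-!
# Linked regular refinement: from one ambient space to a family of fans (coordinate blocks)

Topic: `Literature/Geometry/PolyhedralFans`. The file `LinkedRefinement` states [KempfEtAl1973]
Ch. II §2 Thm. 11* (regular projective subdivision of a conical polyhedral complex with integral
structure, presented by charts) in two forms: `Fan.LinkedRegularRefinement` — ONE rational fan
`Δ₀ ⊆ ℚ^κ` with a set of links — and `Fan.LinkedRegularRefinementFamily` — a FAMILY of rational
fans `Δ₀ i ⊆ ℚ^{n i}`, each in its own coordinate space, with links between cones of different
(or the same) members; the family form is the one consumed by the atlas form of Kato (10.4)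
(`Kato1994_logRegular_hasResolution_general_of_linkedRegularRefinementFamily`). This file proves
the reduction announced in the docstring of `LinkedRefinement`:

  `Fan.linkedRegularRefinementFamily_of_linkedRegularRefinement :
      Fan.LinkedRegularRefinement → Fan.LinkedRegularRefinementFamily`.

The reduction ([KempfEtAl1973] II §1: a complex is a finite disjoint union of cells glued by
charts; here the disjoint union is realised inside ONE coordinate space): put the spaces
`ℚ^{n i}` as the coordinate BLOCKS of `ℚ^κ`, `κ := Σ i, Fin (n i)`, through the block inclusions
`blockInc n i` (with left inverses the block projections `blockProj n i`); the **block sum**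
`Fan.blockSum Δ₀` is the fan whose cones are the images of the cones of all members (cones of two
different blocks meet only in `0`); a family link becomes a link of the block sum (`Fan.blockLink`).
The one-space theorem applied to the block sum gives lattice star subdivisions `l` and one
function `f`; since every cone of the block sum lies in one block, the iterated star subdivision
of the block sum through `l` IS the block sum of the iterated star subdivisions of the members
through the block parts of the vectors of `l` (`Fan.blockSum_starIter_cones`, from the transport
theorem `Fan.mapOn_starSubdivision_cones` of `LinkTransport` and the fact that a star subdivision
through a vector outside the support changes nothing); regularity, simpliciality, the cone-wise
tight strict support data and the link compatibilities are then read back block by block along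
the block inclusions (again by the transport theorems of `LinkTransport`), and `f i := f ∘ blockInc n i`.

All statements are PROVED; no named facts. New definitions: `BlockIdx`, `blockInc`, `blockProj`,
`blockRange`, `Fan.blockEmb`, `Fan.blockSum`, `Fan.blockStar`, `blockList`, `Fan.blockLink`
(bookkeeping of the reduction only).

References: [KempfEtAl1973] Ch. II §1 Def. 5, §2 Thm. 11*; [Kato1994] (9.6)–(9.8), (10.4);
[Fulton1993Toric] §1.4 p. 20–21, §2.6 p. 47–48.
-/

noncomputable section

namespace Literature.Geometry.PolyhedralFans

open PointedCone Finset Matrix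

/-! ## Block coordinates: `ℚ^{n i} ↪ ℚ^κ`, `κ = Σ i, Fin (n i)` -/

section Blocks

variable {ι : Type*} {n : ι → ℕ}

/-- The index type of the big coordinate space holding all members of a family `ℚ^{n i}` as
coordinate blocks: `κ = Σ i, Fin (n i)` ([KempfEtAl1973] II §1: the disjoint union of the cells of
a complex). [cite: KempfEtAl1973, Ch. II §1 Def. 5] -/
abbrev BlockIdx (n : ι → ℕ) : Type _ := Σ i, Fin (n i)

/-- The **block projection** `ℚ^κ → ℚ^{n i}`: the coordinates of block `i`.
[cite: KempfEtAl1973, Ch. II §1 Def. 5] -/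
def blockProj (n : ι → ℕ) (i : ι) : (BlockIdx n → ℚ) →ₗ[ℚ] (Fin (n i) → ℚ) where
  toFun y a := y ⟨i, a⟩
  map_add' _ _ := rfl
  map_smul' _ _ := rfl

/-- The block projection reads the coordinates of block `i`. [cite: KempfEtAl1973, Ch. II §1 Def. 5] -/
@[simp] theorem blockProj_apply (i : ι) (y : BlockIdx n → ℚ) (a : Fin (n i)) :
    blockProj n i y a = y ⟨i, a⟩ := rfl

variable [DecidableEq ι]

/-- The **block inclusion** `ℚ^{n i} ↪ ℚ^κ`: a vector of block `i`, extended by `0` on the other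
blocks. [cite: KempfEtAl1973, Ch. II §1 Def. 5] -/
def blockInc (n : ι → ℕ) (i : ι) : (Fin (n i) → ℚ) →ₗ[ℚ] (BlockIdx n → ℚ) where
  toFun x p := if h : p.1 = i then x (Fin.cast (congrArg n h) p.2) else 0
  map_add' x y := by
    funext p
    by_cases h : p.1 = i
    · simp only [dif_pos h, Pi.add_apply]
    · simp only [dif_neg h, Pi.add_apply, add_zero]
  map_smul' c x := by
    funext p
    by_cases h : p.1 = i
    · simp only [dif_pos h, Pi.smul_apply, smul_eq_mul, RingHom.id_apply]
    · simp only [dif_neg h, Pi.smul_apply, smul_eq_mul, mul_zero, RingHom.id_apply]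

/-- The block inclusion on its own block. [cite: KempfEtAl1973, Ch. II §1 Def. 5] -/
@[simp] theorem blockInc_apply_same (i : ι) (x : Fin (n i) → ℚ) (a : Fin (n i)) :
    blockInc n i x ⟨i, a⟩ = x a := by
  show (if h : (⟨i, a⟩ : BlockIdx n).1 = i then x (Fin.cast (congrArg n h) _) else 0) = x a
  rw [dif_pos rfl]
  rfl

/-- The block inclusion vanishes off its block. [cite: KempfEtAl1973, Ch. II §1 Def. 5] -/
theorem blockInc_apply_of_ne (i : ι) (x : Fin (n i) → ℚ) {p : BlockIdx n} (hp : p.1 ≠ i) :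
    blockInc n i x p = 0 := by
  show (if h : p.1 = i then x (Fin.cast (congrArg n h) p.2) else 0) = 0
  rw [dif_neg hp]

/-- `blockProj i ∘ blockInc i = id`. [cite: KempfEtAl1973, Ch. II §1 Def. 5] -/
@[simp] theorem blockProj_blockInc (i : ι) (x : Fin (n i) → ℚ) :
    blockProj n i (blockInc n i x) = x := by
  funext a
  rw [blockProj_apply, blockInc_apply_same]

/-- `blockProj i ∘ blockInc i = id` as linear maps. [cite: KempfEtAl1973, Ch. II §1 Def. 5] -/
theorem blockProj_comp_blockInc (i : ι) :
    blockProj n i ∘ₗ blockInc n i = LinearMap.id := by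
  ext x a
  simp

/-- `blockProj j ∘ blockInc i = 0` for `j ≠ i`. [cite: KempfEtAl1973, Ch. II §1 Def. 5] -/
theorem blockProj_blockInc_of_ne {i j : ι} (hji : j ≠ i) (x : Fin (n i) → ℚ) :
    blockProj n j (blockInc n i x) = 0 := by
  funext a
  exact blockInc_apply_of_ne i x (p := ⟨j, a⟩) hji

/-- The block inclusion is injective. [cite: KempfEtAl1973, Ch. II §1 Def. 5] -/
theorem blockInc_injective (i : ι) : Function.Injective (blockInc n i) := fun x y h => by
  rw [← blockProj_blockInc i x, ← blockProj_blockInc i y, h]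

/-- The kernel form of injectivity used by `LinkTransport` (on the whole space `U = ⊤`).
[cite: KempfEtAl1973, Ch. II §1 Def. 5] -/
theorem blockInc_eq_zero (i : ι) :
    ∀ x ∈ (⊤ : Submodule ℚ (Fin (n i) → ℚ)), blockInc n i x = 0 → x = 0 :=
  fun x _ h => blockInc_injective i (by rw [h, map_zero])

/-- A vector supported on block `i` is the re-embedding of its block-`i` part.
[cite: KempfEtAl1973, Ch. II §1 Def. 5] -/
theorem blockInc_blockProj_of_forall (i : ι) {y : BlockIdx n → ℚ}
    (hy : ∀ p : BlockIdx n, p.1 ≠ i → y p = 0) : blockInc n i (blockProj n i y) = y := by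
  funext p
  by_cases h : p.1 = i
  · obtain ⟨j, a⟩ := p
    cases h
    rw [blockInc_apply_same, blockProj_apply]
  · rw [blockInc_apply_of_ne i _ h, hy p h]

/-- Two different blocks meet only in `0`. [cite: KempfEtAl1973, Ch. II §1 Def. 5] -/
theorem eq_zero_of_blockInc_eq_blockInc {i j : ι} (hij : i ≠ j) {x : Fin (n i) → ℚ}
    {y : Fin (n j) → ℚ} (h : blockInc n i x = blockInc n j y) : x = 0 := by
  rw [← blockProj_blockInc i x, h, blockProj_blockInc_of_ne hij]

/-- **The block subspace** of block `i` inside `ℚ^κ` (the range of the block inclusion).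
[cite: KempfEtAl1973, Ch. II §1 Def. 5] -/
def blockRange (n : ι → ℕ) (i : ι) : Submodule ℚ (BlockIdx n → ℚ) := LinearMap.range (blockInc n i)

/-- Membership in the block subspace. [cite: KempfEtAl1973, Ch. II §1 Def. 5] -/
theorem mem_blockRange_iff {i : ι} {y : BlockIdx n → ℚ} :
    y ∈ blockRange n i ↔ ∃ x, blockInc n i x = y := LinearMap.mem_range

/-- The block subspace is the image of the whole block. [cite: KempfEtAl1973, Ch. II §1 Def. 5] -/
theorem map_top_blockInc (i : ι) :
    (⊤ : Submodule ℚ (Fin (n i) → ℚ)).map (blockInc n i) = blockRange n i :=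
  Submodule.map_top _

/-- On the block subspace the block projection is injective (kernel form).
[cite: KempfEtAl1973, Ch. II §1 Def. 5] -/
theorem blockProj_eq_zero (i : ι) :
    ∀ y ∈ blockRange n i, blockProj n i y = 0 → y = 0 := by
  rintro _ ⟨x, rfl⟩ h
  rw [blockProj_blockInc] at h
  rw [h, map_zero]

/-! ### Lattice points -/

/-- The block inclusion maps lattice points to lattice points. [cite: KempfEtAl1973, Ch. II §1 Def. 5] -/
theorem blockInc_mem_latticeN (i : ι) {x : Fin (n i) → ℚ} (hx : x ∈ latticeN (Fin (n i))) :
    blockInc n i x ∈ latticeN (BlockIdx n) := by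
  intro p
  by_cases h : p.1 = i
  · obtain ⟨j, a⟩ := p
    cases h
    obtain ⟨m, hm⟩ := hx a
    exact ⟨m, by rw [blockInc_apply_same, hm]⟩
  · exact ⟨0, by rw [blockInc_apply_of_ne i x h, Int.cast_zero]⟩

omit [DecidableEq ι] in
/-- The block projection maps lattice points to lattice points. [cite: KempfEtAl1973, Ch. II §1 Def. 5] -/
theorem blockProj_mem_latticeN (i : ι) {y : BlockIdx n → ℚ} (hy : y ∈ latticeN (BlockIdx n)) :
    blockProj n i y ∈ latticeN (Fin (n i)) :=
  fun a => hy ⟨i, a⟩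

/-- A vector of block `i` is a lattice point iff its embedding is. [cite: KempfEtAl1973, Ch. II §1 Def. 5] -/
theorem mem_latticeN_of_blockInc_mem (i : ι) {x : Fin (n i) → ℚ}
    (h : blockInc n i x ∈ latticeN (BlockIdx n)) : x ∈ latticeN (Fin (n i)) := by
  have h' := blockProj_mem_latticeN i h
  rwa [blockProj_blockInc] at h'

/-- Lattice condition of `LinkTransport` for the block inclusion (forward).
[cite: KempfEtAl1973, Ch. II §1 Def. 5] -/
theorem blockInc_lat (i : ι) : ∀ x ∈ (⊤ : Submodule ℚ (Fin (n i) → ℚ)),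
    x ∈ latticeN (Fin (n i)) → blockInc n i x ∈ latticeN (BlockIdx n) :=
  fun _ _ hx => blockInc_mem_latticeN i hx

/-- Lattice condition of `LinkTransport` for the block inclusion (backward: every lattice point
of the block subspace comes from a lattice point of the block). [cite: KempfEtAl1973, Ch. II §1 Def. 5] -/
theorem blockInc_lat' (i : ι) : ∀ y ∈ latticeN (BlockIdx n),
    y ∈ (⊤ : Submodule ℚ (Fin (n i) → ℚ)).map (blockInc n i) →
      ∃ x ∈ (⊤ : Submodule ℚ (Fin (n i) → ℚ)), x ∈ latticeN (Fin (n i)) ∧ blockInc n i x = y := by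
  intro y hy hy'
  rw [map_top_blockInc, mem_blockRange_iff] at hy'
  obtain ⟨x, rfl⟩ := hy'
  exact ⟨x, Submodule.mem_top, mem_latticeN_of_blockInc_mem i hy, rfl⟩

/-- Lattice condition of `LinkTransport` for the block projection on the block subspace (forward).
[cite: KempfEtAl1973, Ch. II §1 Def. 5] -/
theorem blockProj_lat (i : ι) : ∀ y ∈ blockRange n i,
    y ∈ latticeN (BlockIdx n) → blockProj n i y ∈ latticeN (Fin (n i)) :=
  fun _ _ hy => blockProj_mem_latticeN i hy

/-- Lattice condition of `LinkTransport` for the block projection on the block subspace (backward).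
[cite: KempfEtAl1973, Ch. II §1 Def. 5] -/
theorem blockProj_lat' (i : ι) : ∀ x ∈ latticeN (Fin (n i)),
    x ∈ (blockRange n i).map (blockProj n i) →
      ∃ y ∈ blockRange n i, y ∈ latticeN (BlockIdx n) ∧ blockProj n i y = x :=
  fun x hx _ => ⟨blockInc n i x, ⟨x, rfl⟩, blockInc_mem_latticeN i hx, blockProj_blockInc i x⟩

/-! ### Pairing: `⟨W, blockInc i x⟩ = ⟨blockProj i W, x⟩` -/

/-- **Adjunction of the block maps for the dot product**: pairing a covector of the big space
with an embedded vector of block `i` only sees the block-`i` coordinates of the covector.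
[cite: KempfEtAl1973, Ch. II §1 Def. 5] -/
theorem dotProduct_blockInc [Fintype ι] (i : ι) (W : BlockIdx n → ℚ) (x : Fin (n i) → ℚ) :
    W ⬝ᵥ blockInc n i x = blockProj n i W ⬝ᵥ x := by
  simp only [dotProduct]
  rw [← Finset.univ_sigma_univ, Finset.sum_sigma, Finset.sum_eq_single i]
  · simp only [blockInc_apply_same, blockProj_apply]
  · intro j _ hji
    exact Finset.sum_eq_zero fun a _ => by
      rw [blockInc_apply_of_ne i x (p := ⟨j, a⟩) hji, mul_zero]
  · intro h
    exact absurd (Finset.mem_univ i) h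

/-! ### Cones under the block maps -/

/-- Any cone lies in the whole space (the `⊆ U` hypotheses of `LinkTransport` for `U = ⊤`).
[cite: Fulton1993Toric, §1.4 p. 21] -/
theorem coe_subset_top {V : Type*} [AddCommGroup V] [Module ℚ V] (ρ : PointedCone ℚ V) :
    (ρ : Set V) ⊆ ((⊤ : Submodule ℚ V) : Set V) := fun _ _ => Submodule.mem_top

/-- For cones of one block, embedded inclusion is inclusion. [cite: Fulton1993Toric, §1.4 p. 21] -/
theorem map_blockInc_le_iff (i : ι) {ρ σ : PointedCone ℚ (Fin (n i) → ℚ)} :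
    ρ.map (blockInc n i) ≤ σ.map (blockInc n i) ↔ ρ ≤ σ :=
  map_le_map_iff_of_subset (blockInc_eq_zero i) (coe_subset_top ρ) (coe_subset_top σ)

/-- For cones of one block, embedded equality is equality. [cite: Fulton1993Toric, §1.4 p. 21] -/
theorem map_blockInc_eq_iff (i : ι) {ρ σ : PointedCone ℚ (Fin (n i) → ℚ)} :
    ρ.map (blockInc n i) = σ.map (blockInc n i) ↔ ρ = σ :=
  map_eq_map_iff_of_subset (blockInc_eq_zero i) (coe_subset_top ρ) (coe_subset_top σ)

/-- Membership of an embedded vector in an embedded cone of the same block.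
[cite: Fulton1993Toric, §1.4 p. 21] -/
theorem blockInc_mem_map_iff (i : ι) {ρ : PointedCone ℚ (Fin (n i) → ℚ)} {x : Fin (n i) → ℚ} :
    blockInc n i x ∈ ρ.map (blockInc n i) ↔ x ∈ ρ :=
  map_mem_map_iff_of_subset (blockInc_eq_zero i) (coe_subset_top ρ) Submodule.mem_top

/-- A cone of block `i` embedded below a cone of a DIFFERENT block `j` is the zero cone (two
blocks meet only in `0`). [cite: KempfEtAl1973, Ch. II §1 Def. 5] -/
theorem eq_bot_of_map_blockInc_le {i j : ι} (hij : i ≠ j) {ρ : PointedCone ℚ (Fin (n i) → ℚ)}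
    {σ : PointedCone ℚ (Fin (n j) → ℚ)} (h : ρ.map (blockInc n i) ≤ σ.map (blockInc n j)) :
    ρ = ⊥ := by
  rw [eq_bot_iff]
  intro x hx
  obtain ⟨y, -, hy⟩ := PointedCone.mem_map.mp (h ⟨x, hx, rfl⟩)
  rw [Submodule.mem_bot]
  exact eq_zero_of_blockInc_eq_blockInc hij hy.symm

/-- Re-embedding along `blockProj i` then `blockInc i`: for a cone already of the form
`ρ.map (blockInc i)`, projecting gives `ρ` back. [cite: KempfEtAl1973, Ch. II §1 Def. 5] -/
theorem map_blockProj_map_blockInc (i : ι) (ρ : PointedCone ℚ (Fin (n i) → ℚ)) :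
    (ρ.map (blockInc n i)).map (blockProj n i) = ρ := by
  rw [PointedCone.map_map, blockProj_comp_blockInc, PointedCone.map_id]

end Blocks

/-! ## The block sum of a family of fans -/

section BlockSum

variable {ι : Type*} [DecidableEq ι] {n : ι → ℕ}

namespace Fan

/-- A fan of block `i` placed in the big space `ℚ^κ` (its image under the block inclusion; a fan
by `Fan.mapOn`). [cite: KempfEtAl1973, Ch. II §1 Def. 5] -/
def blockEmb {i : ι} (Δ : Fan ℚ (Fin (n i) → ℚ)) : Fan ℚ (BlockIdx n → ℚ) :=
  Δ.mapOn (blockInc n i) (U := ⊤) (fun _ _ _ _ => Submodule.mem_top) (blockInc_eq_zero i)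

/-- The cones of the embedded fan. [cite: KempfEtAl1973, Ch. II §1 Def. 5] -/
@[simp] theorem blockEmb_cones {i : ι} (Δ : Fan ℚ (Fin (n i) → ℚ)) :
    (blockEmb Δ).cones = (fun σ => σ.map (blockInc n i)) '' Δ.cones := rfl

/-- The cones of an embedded fan lie in its block subspace. [cite: KempfEtAl1973, Ch. II §1 Def. 5] -/
theorem blockEmb_conesSubset {i : ι} (Δ : Fan ℚ (Fin (n i) → ℚ)) :
    (blockEmb Δ).ConesSubset (blockRange n i) := by
  rw [← map_top_blockInc]
  exact conesSubset_mapOn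

/-- The support of an embedded fan is the image of the support. [cite: KempfEtAl1973, Ch. II §1 Def. 5] -/
theorem blockEmb_support {i : ι} (Δ : Fan ℚ (Fin (n i) → ℚ)) :
    (blockEmb Δ).support = blockInc n i '' Δ.support :=
  mapOn_support

/-- Projecting an embedded fan back to its block gives the fan. [cite: KempfEtAl1973, Ch. II §1 Def. 5] -/
theorem blockEmb_mapOn_blockProj {i : ι} (Δ : Fan ℚ (Fin (n i) → ℚ)) :
    (blockEmb Δ).mapOn (blockProj n i) (blockEmb_conesSubset Δ) (blockProj_eq_zero i) = Δ := by
  refine eq_of_cones_eq ?_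
  ext ρ
  simp only [mapOn_cones, blockEmb_cones, Set.mem_image, exists_exists_and_eq_and,
    map_blockProj_map_blockInc, exists_eq_right]

/-- Regularity of a fan of block `i` can be read on its embedding.
[cite: KempfEtAl1973, Ch. II §2 Thm. 11*] -/
theorem IsRegular.of_blockEmb {i : ι} {Δ : Fan ℚ (Fin (n i) → ℚ)} (h : (blockEmb Δ).IsRegular) :
    Δ.IsRegular := by
  classical
  rw [← blockEmb_mapOn_blockProj Δ]
  exact h.mapOn (blockProj_lat i) (blockProj_lat' i)

/-- Simpliciality of a fan of block `i` can be read on its embedding.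
[cite: KempfEtAl1973, Ch. II §2 Thm. 11*] -/
theorem IsSimplicial.of_blockEmb {i : ι} {Δ : Fan ℚ (Fin (n i) → ℚ)}
    (h : (blockEmb Δ).IsSimplicial) : Δ.IsSimplicial := by
  rw [← blockEmb_mapOn_blockProj Δ]
  exact h.mapOn

/-- The embedding of a rational fan is rational. [cite: KempfEtAl1973, Ch. II §2 Thm. 4*] -/
theorem IsRational.blockEmb {i : ι} {Δ : Fan ℚ (Fin (n i) → ℚ)} (h : Δ.IsRational) :
    (blockEmb Δ).IsRational :=
  h.mapOn (blockInc_lat i)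

variable [Fintype ι]

/-- **The block sum** of a family of fans `Δ i ⊆ ℚ^{n i}`: the fan in `ℚ^κ`, `κ = Σ i, Fin (n i)`,
whose cones are the embedded cones of all members ([KempfEtAl1973] II §1: the complex as the
disjoint union of its cells; cones of two different blocks meet only in the origin, a face of
both). [cite: KempfEtAl1973, Ch. II §1 Def. 5] -/
def blockSum (Δ : ∀ i, Fan ℚ (Fin (n i) → ℚ)) : Fan ℚ (BlockIdx n → ℚ) where
  cones := ⋃ i, (blockEmb (Δ i)).cones
  finite := Set.finite_iUnion fun i => (blockEmb (Δ i)).finite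
  fg := by
    intro P hP
    obtain ⟨i, hP⟩ := Set.mem_iUnion.mp hP
    exact (blockEmb (Δ i)).fg hP
  salient := by
    intro P hP
    obtain ⟨i, hP⟩ := Set.mem_iUnion.mp hP
    exact (blockEmb (Δ i)).salient hP
  face_mem := by
    intro P hP F hF
    obtain ⟨i, hP⟩ := Set.mem_iUnion.mp hP
    exact Set.mem_iUnion.mpr ⟨i, (blockEmb (Δ i)).face_mem hP hF⟩
  inf_isFaceOf := by
    intro P hP Q hQ
    obtain ⟨i, hP⟩ := Set.mem_iUnion.mp hP
    obtain ⟨j, hQ⟩ := Set.mem_iUnion.mp hQ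
    by_cases hij : i = j
    · subst hij
      exact (blockEmb (Δ i)).inf_isFaceOf hP hQ
    · -- cones of different blocks meet only in `0`
      have hPQ : P ⊓ Q = ⊥ := by
        obtain ⟨σ, -, rfl⟩ := hP
        obtain ⟨τ, -, rfl⟩ := hQ
        rw [eq_bot_iff]
        rintro y ⟨⟨a, -, rfl⟩, ⟨b, -, hb⟩⟩
        rw [Submodule.mem_bot, eq_zero_of_blockInc_eq_blockInc hij hb.symm, map_zero]
      rw [hPQ]
      exact ((blockEmb (Δ i)).salient hP).bot_isFaceOf

variable {Δ : ∀ i, Fan ℚ (Fin (n i) → ℚ)}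

/-- The cones of the block sum. [cite: KempfEtAl1973, Ch. II §1 Def. 5] -/
theorem blockSum_cones (Δ : ∀ i, Fan ℚ (Fin (n i) → ℚ)) :
    (blockSum Δ).cones = ⋃ i, (blockEmb (Δ i)).cones := rfl

/-- Membership in the block sum. [cite: KempfEtAl1973, Ch. II §1 Def. 5] -/
theorem mem_blockSum_iff {P : PointedCone ℚ (BlockIdx n → ℚ)} :
    P ∈ (blockSum Δ).cones ↔ ∃ i, ∃ σ ∈ (Δ i).cones, σ.map (blockInc n i) = P := by
  simp only [blockSum_cones, Set.mem_iUnion, blockEmb_cones, Set.mem_image]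

/-- The embedded cones of a member are cones of the block sum. [cite: KempfEtAl1973, Ch. II §1 Def. 5] -/
theorem blockEmb_cones_subset (i : ι) : (blockEmb (Δ i)).cones ⊆ (blockSum Δ).cones :=
  Set.subset_iUnion (fun i => (blockEmb (Δ i)).cones) i

/-- An embedded cone of a member is a cone of the block sum. [cite: KempfEtAl1973, Ch. II §1 Def. 5] -/
theorem map_blockInc_mem_blockSum {i : ι} {σ : PointedCone ℚ (Fin (n i) → ℚ)}
    (hσ : σ ∈ (Δ i).cones) : σ.map (blockInc n i) ∈ (blockSum Δ).cones :=
  blockEmb_cones_subset i ⟨σ, hσ, rfl⟩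

/-- **A cone of the block sum below an embedded cone of block `i` is an embedded cone of
member `i`** (provided member `i` has a cone at all, to account for the zero cone).
[cite: KempfEtAl1973, Ch. II §1 Def. 5] -/
theorem exists_eq_map_blockInc_of_le {i : ι} (hne : (Δ i).cones.Nonempty)
    {P : PointedCone ℚ (BlockIdx n → ℚ)} (hP : P ∈ (blockSum Δ).cones)
    {σ : PointedCone ℚ (Fin (n i) → ℚ)} (hle : P ≤ σ.map (blockInc n i)) :
    ∃ ρ ∈ (Δ i).cones, ρ ≤ σ ∧ ρ.map (blockInc n i) = P := by
  obtain ⟨j, τ, hτ, rfl⟩ := mem_blockSum_iff.mp hP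
  by_cases hji : j = i
  · subst hji
    exact ⟨τ, hτ, (map_blockInc_le_iff j).mp hle, rfl⟩
  · have hτ0 : τ = ⊥ := eq_bot_of_map_blockInc_le hji hle
    subst hτ0
    obtain ⟨σ₀, hσ₀⟩ := hne
    refine ⟨⊥, bot_mem hσ₀, bot_le, ?_⟩
    rw [map_bot, map_bot]

/-- For a nonempty member, an embedded cone belongs to the block sum iff the cone belongs to the
member. [cite: KempfEtAl1973, Ch. II §1 Def. 5] -/
theorem map_blockInc_mem_blockSum_iff {i : ι} (hne : (Δ i).cones.Nonempty)
    {σ : PointedCone ℚ (Fin (n i) → ℚ)} :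
    σ.map (blockInc n i) ∈ (blockSum Δ).cones ↔ σ ∈ (Δ i).cones := by
  refine ⟨fun h => ?_, map_blockInc_mem_blockSum⟩
  obtain ⟨ρ, hρ, -, hρσ⟩ := exists_eq_map_blockInc_of_le hne h le_rfl
  rwa [← (map_blockInc_eq_iff i).mp hρσ]

/-- The support of the block sum is the union of the embedded supports.
[cite: KempfEtAl1973, Ch. II §1 Def. 5] -/
theorem mem_blockSum_support_iff {y : BlockIdx n → ℚ} :
    y ∈ (blockSum Δ).support ↔ ∃ i, ∃ x ∈ (Δ i).support, blockInc n i x = y := by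
  constructor
  · intro hy
    obtain ⟨P, hP, hyP⟩ := mem_support.mp hy
    obtain ⟨i, σ, hσ, rfl⟩ := mem_blockSum_iff.mp hP
    obtain ⟨x, hx, rfl⟩ := PointedCone.mem_map.mp hyP
    exact ⟨i, x, mem_support.mpr ⟨σ, hσ, hx⟩, rfl⟩
  · rintro ⟨i, x, hx, rfl⟩
    obtain ⟨σ, hσ, hxσ⟩ := mem_support.mp hx
    exact mem_support.mpr ⟨σ.map (blockInc n i), map_blockInc_mem_blockSum hσ, ⟨x, hxσ, rfl⟩⟩

/-- The block sum of rational fans is rational. [cite: KempfEtAl1973, Ch. II §2 Thm. 4*] -/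
theorem isRational_blockSum (h : ∀ i, (Δ i).IsRational) : (blockSum Δ).IsRational := by
  intro P hP
  obtain ⟨i, hP⟩ := Set.mem_iUnion.mp hP
  exact (h i).blockEmb hP

/-- A member of the block sum with a cone `σ` is nonempty, and so is any fan with the same
support (used for the refined members). [cite: Fulton1993Toric, §1.4 p. 20] -/
theorem cones_nonempty_of_support_eq {V : Type*} [AddCommGroup V] [Module ℚ V]
    {Δ₁ Δ₂ : Fan ℚ V} (h : Δ₁.support = Δ₂.support) {σ : PointedCone ℚ V} (hσ : σ ∈ Δ₂.cones) :
    Δ₁.cones.Nonempty := by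
  have h0 : (0 : V) ∈ Δ₁.support := by
    rw [h]
    exact mem_support.mpr ⟨σ, hσ, σ.zero_mem⟩
  obtain ⟨ρ, hρ, -⟩ := mem_support.mp h0
  exact ⟨ρ, hρ⟩

/-! ### Star subdivisions of the block sum -/

/-- **Star subdivision of a union of down-closed sub-collections.** If the cones of a fan `B`
are the union of the cones of fans `C j`, each down-closed in `B` (a cone of `B` below a cone of
`C j` is a cone of `C j`), then the star subdivision of `B` through `w` is, cone-set-wise, the
union of the star subdivisions of the `C j` through `w` ([Fulton1993Toric] §2.6 p. 47: the star
subdivision is built cone by cone from the cones containing `w` and their faces).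
[cite: Fulton1993Toric, §2.6 p. 47] -/
theorem starSubdivision_cones_eq_iUnion {V : Type*} [AddCommGroup V] [Module ℚ V] {J : Type*}
    {B : Fan ℚ V} (C : J → Fan ℚ V) (hcov : B.cones = ⋃ j, (C j).cones)
    (hdown : ∀ j ⦃T : PointedCone ℚ V⦄, T ∈ B.cones → ∀ ⦃S : PointedCone ℚ V⦄, S ∈ (C j).cones →
      T ≤ S → T ∈ (C j).cones) (w : V) :
    (B.starSubdivision w).cones = ⋃ j, ((C j).starSubdivision w).cones := by
  have hmemB : ∀ {T : PointedCone ℚ V}, T ∈ B.cones ↔ ∃ j, T ∈ (C j).cones := fun {T} => by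
    rw [hcov, Set.mem_iUnion]
  ext ρ
  simp only [starSubdivision_cones, Set.mem_iUnion]
  constructor
  · intro hρ
    rcases mem_starCones_iff.mp hρ with ⟨hρB, hw⟩ | ⟨τ, hτB, hwτ, ⟨σ, hσB, hτσ, hwσ⟩, rfl⟩
    · obtain ⟨j, hρj⟩ := hmemB.mp hρB
      exact ⟨j, mem_starCones_of_not_mem hρj hw⟩
    · obtain ⟨j, hσj⟩ := hmemB.mp hσB
      exact ⟨j, sup_ray_mem_starCones (hdown j hτB hσj hτσ) hwτ hσj hτσ hwσ⟩
  · rintro ⟨j, hρ⟩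
    rcases mem_starCones_iff.mp hρ with ⟨hρj, hw⟩ | ⟨τ, hτj, hwτ, ⟨σ, hσj, hτσ, hwσ⟩, rfl⟩
    · exact mem_starCones_of_not_mem (hmemB.mpr ⟨j, hρj⟩) hw
    · exact sup_ray_mem_starCones (hmemB.mpr ⟨j, hτj⟩) hwτ (hmemB.mpr ⟨j, hσj⟩) hτσ hwσ

open Classical in
/-- The member-wise effect of a star subdivision of the block sum through a vector `w` of the big
space: the member in whose block `w` lies is star-subdivided through the block part of `w`, the
other members are unchanged. [cite: KempfEtAl1973, Ch. II §2 Thm. 4*] -/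
def blockStar (Δ : ∀ i, Fan ℚ (Fin (n i) → ℚ)) (w : BlockIdx n → ℚ) (j : ι) :
    Fan ℚ (Fin (n j) → ℚ) :=
  if blockInc n j (blockProj n j w) = w then (Δ j).starSubdivision (blockProj n j w) else Δ j

/-- **Star subdivision of the block sum is member-wise** (cone sets).
[cite: KempfEtAl1973, Ch. II §2 Thm. 4*] -/
theorem blockSum_starSubdivision_cones (Δ : ∀ i, Fan ℚ (Fin (n i) → ℚ)) (w : BlockIdx n → ℚ) :
    ((blockSum Δ).starSubdivision w).cones = (blockSum (blockStar Δ w)).cones := by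
  have hdown : ∀ j ⦃T : PointedCone ℚ (BlockIdx n → ℚ)⦄, T ∈ (blockSum Δ).cones →
      ∀ ⦃S⦄, S ∈ (blockEmb (Δ j)).cones → T ≤ S → T ∈ (blockEmb (Δ j)).cones := by
    rintro j T hT _ ⟨σ, hσ, rfl⟩ hle
    obtain ⟨ρ, hρ, -, rfl⟩ := exists_eq_map_blockInc_of_le ⟨σ, hσ⟩ hT hle
    exact ⟨ρ, hρ, rfl⟩
  rw [starSubdivision_cones_eq_iUnion (fun j => blockEmb (Δ j)) rfl hdown w, blockSum_cones]
  refine Set.iUnion_congr fun j => ?_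
  by_cases hw : blockInc n j (blockProj n j w) = w
  · -- `w` lies in block `j`: transport of the star subdivision through `blockProj j w`
    rw [blockStar, if_pos hw]
    have h := mapOn_starSubdivision_cones (Δ := Δ j) (E := blockInc n j) (U := ⊤)
      (hΔ := fun _ _ _ _ => Submodule.mem_top) (hinj := blockInc_eq_zero j) (v := blockProj n j w)
      Submodule.mem_top
    rw [hw] at h
    exact h.symm
  · -- `w` is not in block `j`: nothing changes there
    rw [blockStar, if_neg hw]
    refine starSubdivision_cones_of_not_mem_support fun hmem => hw ?_
    rw [blockEmb_support] at hmem
    obtain ⟨x, -, rfl⟩ := hmem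
    rw [blockProj_blockInc]

end Fan

open Classical in
/-- The block-`j` parts of those vectors of a list of the big space that lie in block `j`, in
order (the star subdivision data of member `j`). [cite: KempfEtAl1973, Ch. II §2 Thm. 4*] -/
def blockList (n : ι → ℕ) (j : ι) : List (BlockIdx n → ℚ) → List (Fin (n j) → ℚ)
  | [] => []
  | w :: l => if blockInc n j (blockProj n j w) = w then blockProj n j w :: blockList n j l
      else blockList n j l

/-- Every vector of `blockList n j l` is the block-`j` part of a vector of `l` lying in block `j`.
[cite: KempfEtAl1973, Ch. II §2 Thm. 4*] -/
theorem exists_of_mem_blockList (j : ι) :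
    ∀ (l : List (BlockIdx n → ℚ)) {v : Fin (n j) → ℚ}, v ∈ blockList n j l →
      ∃ w ∈ l, blockInc n j v = w
  | [], _, hv => by simp [blockList] at hv
  | w :: l, v, hv => by
    rw [blockList] at hv
    by_cases hw : blockInc n j (blockProj n j w) = w
    · rw [if_pos hw, List.mem_cons] at hv
      rcases hv with rfl | hv
      · exact ⟨w, List.mem_cons_self, hw⟩
      · obtain ⟨w', hw', h⟩ := exists_of_mem_blockList j l hv
        exact ⟨w', List.mem_cons_of_mem w hw', h⟩
    · rw [if_neg hw] at hv
      obtain ⟨w', hw', h⟩ := exists_of_mem_blockList j l hv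
      exact ⟨w', List.mem_cons_of_mem w hw', h⟩

/-- The block lists of a list of nonzero lattice vectors consist of nonzero lattice vectors.
[cite: KempfEtAl1973, Ch. II §2 Thm. 11*] -/
theorem blockList_latticeN_ne_zero (j : ι) {l : List (BlockIdx n → ℚ)}
    (hl : ∀ w ∈ l, w ∈ latticeN (BlockIdx n) ∧ w ≠ 0) :
    ∀ v ∈ blockList n j l, v ∈ latticeN (Fin (n j)) ∧ v ≠ 0 := by
  intro v hv
  obtain ⟨w, hw, hvw⟩ := exists_of_mem_blockList j l hv
  obtain ⟨hwN, hw0⟩ := hl w hw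
  subst hvw
  exact ⟨mem_latticeN_of_blockInc_mem j hwN, fun h => hw0 (by rw [h, map_zero])⟩

namespace Fan

variable [Fintype ι] {Δ : ∀ i, Fan ℚ (Fin (n i) → ℚ)}

/-- One step of the member-wise bookkeeping: iterating from `blockStar Δ w j` through
`blockList n j l` is iterating from `Δ j` through `blockList n j (w :: l)`.
[cite: KempfEtAl1973, Ch. II §2 Thm. 4*] -/
theorem blockStar_starIter_blockList (Δ : ∀ i, Fan ℚ (Fin (n i) → ℚ)) (w : BlockIdx n → ℚ)
    (j : ι) (l : List (BlockIdx n → ℚ)) :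
    (blockStar Δ w j).starIter (blockList n j l) = (Δ j).starIter (blockList n j (w :: l)) := by
  rw [blockStar, blockList]
  by_cases hw : blockInc n j (blockProj n j w) = w
  · rw [if_pos hw, if_pos hw, starIter_cons]
  · rw [if_neg hw, if_neg hw]

/-- **Iterated star subdivision of the block sum is member-wise** (cone sets): subdividing the
block sum through `l` is the block sum of the members subdivided through their block lists.
[cite: KempfEtAl1973, Ch. II §2 Thm. 4*] -/
theorem blockSum_starIter_cones :
    ∀ (l : List (BlockIdx n → ℚ)) (Δ : ∀ i, Fan ℚ (Fin (n i) → ℚ)),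
      ((blockSum Δ).starIter l).cones = (blockSum fun j => (Δ j).starIter (blockList n j l)).cones
  | [], _ => rfl
  | w :: l, Δ => by
    have h1 : (blockSum Δ).starSubdivision w = blockSum (blockStar Δ w) :=
      eq_of_cones_eq (blockSum_starSubdivision_cones Δ w)
    rw [starIter_cons, h1, blockSum_starIter_cones l (blockStar Δ w)]
    exact congrArg (fun F : ∀ i, Fan ℚ (Fin (n i) → ℚ) => (blockSum F).cones)
      (funext fun j => blockStar_starIter_blockList Δ w j l)

/-! ### Reading the cone-wise data of the block sum back in a member -/

/-- The cones of member `i` inside `σ` correspond to the cones of the block sum inside the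
embedded `σ`. [cite: KempfEtAl1973, Ch. II §1 Def. 5] -/
theorem map_blockInc_mem_restrict_iff {i : ι} (hne : (Δ i).cones.Nonempty)
    {σ τ : PointedCone ℚ (Fin (n i) → ℚ)} :
    τ.map (blockInc n i) ∈ ((blockSum Δ).restrict (σ.map (blockInc n i))).cones ↔
      τ ∈ ((Δ i).restrict σ).cones := by
  rw [mem_restrict_iff, mem_restrict_iff, map_blockInc_mem_blockSum_iff hne, map_blockInc_le_iff]

/-- **The cone-wise conclusion of [KempfEtAl1973] I §2 Thm. 11 descends from the block sum to a
member**: if the cones of the block sum inside the embedded cone `σ` of member `i` cover it and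
carry integral tight strict support data `M`, non-negative on it, with minimum function `f`, then
the cones of member `i` inside `σ` cover `σ` and carry the data `τ ↦ blockProj i (M (τ.map ι_i))`
with minimum function `f ∘ blockInc i`. [cite: KempfEtAl1973, Ch. II §2 Thm. 11*] -/
theorem restrict_transfer_of_blockSum {i : ι} (hne : (Δ i).cones.Nonempty)
    {σ : PointedCone ℚ (Fin (n i) → ℚ)} (f : (BlockIdx n → ℚ) → ℚ)
    (hsupp : ((blockSum Δ).restrict (σ.map (blockInc n i))).support =
      (σ.map (blockInc n i) : Set (BlockIdx n → ℚ)))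
    {M : PointedCone ℚ (BlockIdx n → ℚ) → (BlockIdx n → ℚ)}
    (hM : ((blockSum Δ).restrict (σ.map (blockInc n i))).IsStrictSupport M)
    (hMτ : ∀ T ∈ ((blockSum Δ).restrict (σ.map (blockInc n i))).cones,
      M T ∈ latticeN (BlockIdx n) ∧ (∀ X ∈ σ.map (blockInc n i), 0 ≤ M T ⬝ᵥ X) ∧
        ∀ X ∈ T, M T ⬝ᵥ X = f X) :
    ((Δ i).restrict σ).support = (σ : Set (Fin (n i) → ℚ)) ∧
      ∃ m : PointedCone ℚ (Fin (n i) → ℚ) → (Fin (n i) → ℚ),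
        ((Δ i).restrict σ).IsStrictSupport m ∧
        ∀ τ ∈ ((Δ i).restrict σ).cones,
          m τ ∈ latticeN (Fin (n i)) ∧ (∀ x ∈ σ, 0 ≤ m τ ⬝ᵥ x) ∧
            ∀ x ∈ τ, m τ ⬝ᵥ x = f (blockInc n i x) := by
  refine ⟨?_, fun τ => blockProj n i (M (τ.map (blockInc n i))), ?_, fun τ hτ => ⟨?_, ?_, ?_⟩⟩
  · -- the cones of member `i` inside `σ` cover `σ`
    refine le_antisymm (restrict_support_subset σ) fun x hx => ?_
    have hX : blockInc n i x ∈ ((blockSum Δ).restrict (σ.map (blockInc n i))).support := by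
      rw [hsupp]
      exact ⟨x, hx, rfl⟩
    obtain ⟨T, ⟨hT, hTσ⟩, hxT⟩ := mem_support.mp hX
    obtain ⟨ρ, hρ, hρσ, rfl⟩ := exists_eq_map_blockInc_of_le hne hT hTσ
    exact mem_support.mpr ⟨ρ, ⟨hρ, hρσ⟩, (blockInc_mem_map_iff i).mp hxT⟩
  · -- tight strict support data
    intro ρ hρ ρ' hρ' u hu
    have hP := (map_blockInc_mem_restrict_iff hne).mpr hρ
    have hP' := (map_blockInc_mem_restrict_iff hne).mpr hρ'
    obtain ⟨h1, h2⟩ := hM hP hP' ((blockInc_mem_map_iff i).mpr hu)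
    rw [dotProduct_blockInc, dotProduct_blockInc] at h1 h2
    exact ⟨h1, fun h => (blockInc_mem_map_iff i).mp (h2 h)⟩
  · -- integrality
    exact blockProj_mem_latticeN i (hMτ _ ((map_blockInc_mem_restrict_iff hne).mpr hτ)).1
  · -- non-negativity on `σ`
    intro x hx
    rw [← dotProduct_blockInc]
    exact (hMτ _ ((map_blockInc_mem_restrict_iff hne).mpr hτ)).2.1 _ ⟨x, hx, rfl⟩
  · -- the minimum function
    intro x hx
    rw [← dotProduct_blockInc]
    exact (hMτ _ ((map_blockInc_mem_restrict_iff hne).mpr hτ)).2.2 _ ⟨x, hx, rfl⟩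

/-! ### Links of a family as links of the block sum -/

/-- **A family link as a link of the block sum**: source and target are the embedded cones, the
link map is `blockInc j ∘ ℓ ∘ blockProj i`. [cite: KempfEtAl1973, Ch. II §1 Def. 5] -/
def blockLink (Δ : ∀ i, Fan ℚ (Fin (n i) → ℚ)) (ℓ : Fan.FamilyLink n Δ) : (blockSum Δ).Link where
  src := ℓ.src.map (blockInc n ℓ.i)
  tgt := ℓ.tgt.map (blockInc n ℓ.j)
  src_mem := map_blockInc_mem_blockSum ℓ.src_mem
  tgt_mem := map_blockInc_mem_blockSum ℓ.tgt_mem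
  toLin := blockInc n ℓ.j ∘ₗ ℓ.toLin ∘ₗ blockProj n ℓ.i
  invLin := blockInc n ℓ.i ∘ₗ ℓ.invLin ∘ₗ blockProj n ℓ.j
  mapsTo := by
    intro y hy
    obtain ⟨x, hx, rfl⟩ := PointedCone.mem_map.mp hy
    refine PointedCone.mem_map.mpr ⟨ℓ.toLin x, ℓ.mapsTo x hx, ?_⟩
    simp only [LinearMap.coe_comp, Function.comp_apply, blockProj_blockInc]
  mapsTo_inv := by
    intro y hy
    obtain ⟨x, hx, rfl⟩ := PointedCone.mem_map.mp hy
    refine PointedCone.mem_map.mpr ⟨ℓ.invLin x, ℓ.mapsTo_inv x hx, ?_⟩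
    simp only [LinearMap.coe_comp, Function.comp_apply, blockProj_blockInc]
  left_inv := by
    intro y hy
    obtain ⟨x, hx, rfl⟩ := PointedCone.mem_map.mp hy
    simp only [LinearMap.coe_comp, Function.comp_apply, blockProj_blockInc, ℓ.left_inv x hx]
  right_inv := by
    intro y hy
    obtain ⟨x, hx, rfl⟩ := PointedCone.mem_map.mp hy
    simp only [LinearMap.coe_comp, Function.comp_apply, blockProj_blockInc, ℓ.right_inv x hx]
  integral := by
    intro y hy hN
    obtain ⟨x, hx, rfl⟩ := PointedCone.mem_map.mp hy
    simp only [LinearMap.coe_comp, Function.comp_apply, blockProj_blockInc]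
    exact blockInc_mem_latticeN ℓ.j (ℓ.integral x hx (mem_latticeN_of_blockInc_mem ℓ.i hN))
  integral_inv := by
    intro y hy hN
    obtain ⟨x, hx, rfl⟩ := PointedCone.mem_map.mp hy
    simp only [LinearMap.coe_comp, Function.comp_apply, blockProj_blockInc]
    exact blockInc_mem_latticeN ℓ.i (ℓ.integral_inv x hx (mem_latticeN_of_blockInc_mem ℓ.j hN))

/-- The block link of the inverse family link is the inverse block link.
[cite: KempfEtAl1973, Ch. II §1 Def. 5] -/
theorem blockLink_symm (Δ : ∀ i, Fan ℚ (Fin (n i) → ℚ)) (ℓ : Fan.FamilyLink n Δ) :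
    blockLink Δ ℓ.symm = (blockLink Δ ℓ).symm := rfl

/-- The block link map on an embedded cone of block `ℓ.i`: it is the embedding of the image cone.
[cite: KempfEtAl1973, Ch. II §1 Def. 5] -/
theorem map_blockLink_toLin (Δ : ∀ i, Fan ℚ (Fin (n i) → ℚ)) (ℓ : Fan.FamilyLink n Δ)
    (ρ : PointedCone ℚ (Fin (n ℓ.i) → ℚ)) :
    (ρ.map (blockInc n ℓ.i)).map (blockLink Δ ℓ).toLin = (ρ.map ℓ.toLin).map (blockInc n ℓ.j) := by
  show (ρ.map (blockInc n ℓ.i)).map (blockInc n ℓ.j ∘ₗ ℓ.toLin ∘ₗ blockProj n ℓ.i) = _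
  rw [PointedCone.map_map, PointedCone.map_map, LinearMap.comp_assoc, LinearMap.comp_assoc,
    blockProj_comp_blockInc, LinearMap.comp_id]

/-- **Link compatibility descends from the block sum to the family**: if a block sum `blockSum Δ'`
(of refinements `Δ' i` of the members) is compatible with the block link of `ℓ`, then the family
`Δ'` is compatible with `ℓ`. [cite: KempfEtAl1973, Ch. II §2 Thm. 11*] -/
theorem familyLinkCompatible_of_blockSum {Δ₀ Δ' : ∀ i, Fan ℚ (Fin (n i) → ℚ)}
    (ℓ : Fan.FamilyLink n Δ₀) (hne : (Δ' ℓ.j).cones.Nonempty)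
    (h : Fan.LinkCompatible (blockSum Δ') (blockLink Δ₀ ℓ)) :
    Fan.FamilyLinkCompatible Δ' ℓ := by
  intro ρ hρ
  have h1 : ρ.map (blockInc n ℓ.i) ∈ ((blockSum Δ').restrict (blockLink Δ₀ ℓ).src).cones :=
    ⟨map_blockInc_mem_blockSum hρ.1, map_mono' _ hρ.2⟩
  have h2 := h _ h1
  rw [map_blockLink_toLin] at h2
  exact (map_blockInc_mem_restrict_iff hne).mp h2

end Fan

end BlockSum

/-! ## The reduction -/

/-- **[KempfEtAl1973] Ch. II §2 Thm. 11* for a family of fans follows from the one-space form**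
(the reduction announced in `LinkedRefinement`): place the members `Δ₀ i ⊆ ℚ^{n i}` as the
coordinate blocks of `ℚ^κ`, `κ = Σ i, Fin (n i)`, apply `Fan.LinkedRegularRefinement` to the block
sum with the block links, and read the refinement, the function `f` and all conclusions back block
by block (`Fan.blockSum_starIter_cones`, `Fan.restrict_transfer_of_blockSum`,
`Fan.familyLinkCompatible_of_blockSum`). [cite: KempfEtAl1973, Ch. II §2 Thm. 11*] -/
theorem Fan.linkedRegularRefinementFamily_of_linkedRegularRefinement
    (H : Fan.LinkedRegularRefinement) : Fan.LinkedRegularRefinementFamily := by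
  intro ι _ n Δ₀ hrat L
  classical
  obtain ⟨l, hl, -, hreg, hsimp, f, hf0, hσ, hL⟩ :=
    H (BlockIdx n) (Fan.blockSum Δ₀) (Fan.isRational_blockSum hrat) (Fan.blockLink Δ₀ '' L)
  -- the refined members and the member-wise description of the refined block sum
  obtain ⟨Δ', hΔ'⟩ : ∃ Δ' : ∀ i, Fan ℚ (Fin (n i) → ℚ),
      Δ' = fun i => (Δ₀ i).starIter (blockList n i l) := ⟨_, rfl⟩
  have hfan : (Fan.blockSum Δ₀).starIter l = Fan.blockSum Δ' := by
    rw [hΔ']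
    exact Fan.eq_of_cones_eq (Fan.blockSum_starIter_cones l Δ₀)
  rw [hfan] at hreg hsimp hσ hL
  have hl' : ∀ i, ∀ v ∈ blockList n i l, v ∈ latticeN (Fin (n i)) ∧ v ≠ 0 :=
    fun i => blockList_latticeN_ne_zero i hl
  have hsupp' : ∀ i, (Δ' i).support = (Δ₀ i).support := fun i => by
    rw [hΔ']
    exact Fan.starIter_support_eq _ fun v hv => (hl' i v hv).2
  have hne' : ∀ {i} {σ : PointedCone ℚ (Fin (n i) → ℚ)}, σ ∈ (Δ₀ i).cones →
      (Δ' i).cones.Nonempty := fun {i} {σ} hσ => Fan.cones_nonempty_of_support_eq (hsupp' i) hσ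
  have hmem : ∀ i, (Δ₀ i).starIter (blockList n i l) = Δ' i := fun i => by rw [hΔ']
  refine ⟨fun i => blockList n i l, fun i x => f (blockInc n i x), fun i => ⟨hl' i, ?_, ?_, ?_,
    fun x => hf0 _, fun σ hσ₀ => ?_⟩, fun ℓ hℓ => ?_⟩
  · -- refinement
    show ((Δ₀ i).starIter (blockList n i l)).Refines (Δ₀ i)
    refine ⟨fun ρ hρ => Fan.starIter_exists_le _ hρ, ?_⟩
    rw [hmem i]
    exact hsupp' i
  · -- regularity, read on block `i` of the refined block sum
    show ((Δ₀ i).starIter (blockList n i l)).IsRegular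
    rw [hmem i]
    exact Fan.IsRegular.of_blockEmb fun P hP => hreg (Fan.blockEmb_cones_subset i hP)
  · -- simpliciality
    show ((Δ₀ i).starIter (blockList n i l)).IsSimplicial
    rw [hmem i]
    exact Fan.IsSimplicial.of_blockEmb fun P hP => hsimp (Fan.blockEmb_cones_subset i hP)
  · -- the cone-wise tight strict support data
    show (((Δ₀ i).starIter (blockList n i l)).restrict σ).support = (σ : Set (Fin (n i) → ℚ)) ∧
      ∃ m : PointedCone ℚ (Fin (n i) → ℚ) → (Fin (n i) → ℚ),
        (((Δ₀ i).starIter (blockList n i l)).restrict σ).IsStrictSupport m ∧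
        ∀ τ ∈ (((Δ₀ i).starIter (blockList n i l)).restrict σ).cones,
          m τ ∈ latticeN (Fin (n i)) ∧ (∀ x ∈ σ, 0 ≤ m τ ⬝ᵥ x) ∧
            ∀ x ∈ τ, m τ ⬝ᵥ x = f (blockInc n i x)
    rw [hmem i]
    obtain ⟨hsupp, M, hM, hMτ⟩ := hσ (Fan.map_blockInc_mem_blockSum hσ₀)
    exact Fan.restrict_transfer_of_blockSum (hne' hσ₀) f hsupp hM hMτ
  · -- the links
    obtain ⟨hc, hc', hf⟩ := hL (Fan.blockLink Δ₀ ℓ) ⟨ℓ, hℓ, rfl⟩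
    have hΔ'eq : (fun i => (Δ₀ i).starIter (blockList n i l)) = Δ' := hΔ'.symm
    rw [hΔ'eq]
    refine ⟨Fan.familyLinkCompatible_of_blockSum ℓ (hne' ℓ.tgt_mem) hc,
      Fan.familyLinkCompatible_of_blockSum ℓ.symm (hne' ℓ.src_mem) ?_, fun x hx => ?_⟩
    · rw [Fan.blockLink_symm]
      exact hc'
    · have h := hf (blockInc n ℓ.i x) ⟨x, hx, rfl⟩
      simp only [Fan.blockLink, LinearMap.coe_comp, Function.comp_apply, blockProj_blockInc] at h
      exact h

end Literature.Geometry.PolyhedralFans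

end
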